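import Summits.QuantumFields.QCD.Theorems.QuarksAsStableActionStableActionBridgeTimeKernelPosDef

/-!
# Nilpotency of the pair coupling `N = P⁻DP⁺` and invertibility of `1 − N`
(helper for crux stmt-QuantumFields-9737 `QuarksAsStableAction.StableActionBridge`, line `Sketch` —
stub `sliceNilp_mul_self_and_isUnit`)

In the charge-conserving form of the fermionic one-step transfer operator of `r = 1` Wilson quarks
(Smit, *Introduction to Quantum Fields on a Lattice*, §6.5 (6.84), (6.91); Lüscher 1977) the
one-particle matrix is `M_F(U) = (1 − N)(A⁻¹ ⊗ P⁺ + A ⊗ P⁻)(1 − N)ᴴ` with the pair coupling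
`N = (1 ⊗ P⁻) D (1 ⊗ P⁺)` (the tree's `sliceNilp`), `P± = ½ (1 ± γ₄)` (`timeProjPlus`,
`timeProjMinus`).  Since `P⁺P⁻ = 0` (`timeProjPlus_mul_timeProjMinus`), the inner factor
`(1 ⊗ P⁺)(1 ⊗ P⁻)` of `N²` vanishes, so `N² = 0`; hence `(1 − N)(1 + N) = 1 = (1 + N)(1 − N)` and
`1 − N` is a unit.  This is the registered stub `sliceNilp_mul_self_and_isUnit`, consumed by the
lead's Lüscher-positivity assembly of `fermionSliceMatrix`.

The only work is the Kronecker bookkeeping of the tree's `sliceKron B Γ` ("`B ⊗ Γ`" on the slice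
quark modes `flavour × (site × colour × spin)`, `B` spin-blind, `Γ` a `4 × 4` spin matrix): we
identify it once with Mathlib's Kronecker product `B ⊗ₖ Γ` transported along the reassociation
`(flavour × (site × colour)) × spin ≃ flavour × (site × (colour × spin))` by the algebra equivalence
`Matrix.reindexAlgEquiv` (`sliceKron_eq_reindex`, entrywise `rfl`), and export the resulting
toolkit (`sliceKron_mul`, `sliceKron_one_one`, `sliceKron_conjTranspose`, additivity, scalars,
sums, determinant, the lifted spin-projection identities) in the sub-namespace `SliceNilpotent` for
reuse by the other atoms of the package; the `4 × 4` identities of `P±` are the tree's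
`timeProjPlus_mul_timeProjMinus` and the landed `TimeKernelPosDef.*` (imported).  Pure theorem file
(no definitions).
-/

noncomputable section

namespace Summit.QuantumFields.QCD.Cruxes.StableActionBridge.Sketch

open scoped ComplexOrder
open Literature.MathematicalPhysics.QuantumFieldTheory Literature.MathematicalPhysics.QuantumLattice
open Literature.Probability.LatticeModels (TorusSite)

namespace SliceNilpotent

open Matrix
open scoped Kronecker

variable {Nf S : ℕ}

/-! ### Entrywise linearity of `sliceKron` (no finiteness of the torus needed) -/

/-- Additivity in the spin-blind factor: `(B₁ + B₂) ⊗ Γ = B₁ ⊗ Γ + B₂ ⊗ Γ`. -/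
theorem sliceKron_add_left (B₁ B₂ : Matrix (SliceColourVar Nf S) (SliceColourVar Nf S) ℂ)
    (Γ : Matrix (Fin 4) (Fin 4) ℂ) :
    sliceKron (B₁ + B₂) Γ = sliceKron B₁ Γ + sliceKron B₂ Γ := by
  ext p q
  simp only [sliceKron, Matrix.of_apply, Matrix.add_apply, add_mul]

/-- Additivity in the spin factor: `B ⊗ (Γ₁ + Γ₂) = B ⊗ Γ₁ + B ⊗ Γ₂`. -/
theorem sliceKron_add_right (B : Matrix (SliceColourVar Nf S) (SliceColourVar Nf S) ℂ)
    (Γ₁ Γ₂ : Matrix (Fin 4) (Fin 4) ℂ) :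
    sliceKron B (Γ₁ + Γ₂) = sliceKron B Γ₁ + sliceKron B Γ₂ := by
  ext p q
  simp only [sliceKron, Matrix.of_apply, Matrix.add_apply, mul_add]

/-- `0 ⊗ Γ = 0`. -/
theorem sliceKron_zero_left (Γ : Matrix (Fin 4) (Fin 4) ℂ) :
    sliceKron (0 : Matrix (SliceColourVar Nf S) (SliceColourVar Nf S) ℂ) Γ = 0 := by
  ext p q
  simp only [sliceKron, Matrix.of_apply, Matrix.zero_apply, zero_mul]

/-- `B ⊗ 0 = 0`. -/
theorem sliceKron_zero_right (B : Matrix (SliceColourVar Nf S) (SliceColourVar Nf S) ℂ) :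
    sliceKron B (0 : Matrix (Fin 4) (Fin 4) ℂ) = 0 := by
  ext p q
  simp only [sliceKron, Matrix.of_apply, Matrix.zero_apply, mul_zero]

/-- Negation in the spin-blind factor: `(-B) ⊗ Γ = -(B ⊗ Γ)`. -/
theorem sliceKron_neg_left (B : Matrix (SliceColourVar Nf S) (SliceColourVar Nf S) ℂ)
    (Γ : Matrix (Fin 4) (Fin 4) ℂ) : sliceKron (-B) Γ = -sliceKron B Γ := by
  ext p q
  simp only [sliceKron, Matrix.of_apply, Matrix.neg_apply, neg_mul]

/-- Negation in the spin factor: `B ⊗ (-Γ) = -(B ⊗ Γ)`. -/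
theorem sliceKron_neg_right (B : Matrix (SliceColourVar Nf S) (SliceColourVar Nf S) ℂ)
    (Γ : Matrix (Fin 4) (Fin 4) ℂ) : sliceKron B (-Γ) = -sliceKron B Γ := by
  ext p q
  simp only [sliceKron, Matrix.of_apply, Matrix.neg_apply, mul_neg]

/-- Subtraction in the spin-blind factor: `(B₁ - B₂) ⊗ Γ = B₁ ⊗ Γ - B₂ ⊗ Γ`. -/
theorem sliceKron_sub_left (B₁ B₂ : Matrix (SliceColourVar Nf S) (SliceColourVar Nf S) ℂ)
    (Γ : Matrix (Fin 4) (Fin 4) ℂ) :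
    sliceKron (B₁ - B₂) Γ = sliceKron B₁ Γ - sliceKron B₂ Γ := by
  ext p q
  simp only [sliceKron, Matrix.of_apply, Matrix.sub_apply, sub_mul]

/-- Subtraction in the spin factor: `B ⊗ (Γ₁ - Γ₂) = B ⊗ Γ₁ - B ⊗ Γ₂`. -/
theorem sliceKron_sub_right (B : Matrix (SliceColourVar Nf S) (SliceColourVar Nf S) ℂ)
    (Γ₁ Γ₂ : Matrix (Fin 4) (Fin 4) ℂ) :
    sliceKron B (Γ₁ - Γ₂) = sliceKron B Γ₁ - sliceKron B Γ₂ := by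
  ext p q
  simp only [sliceKron, Matrix.of_apply, Matrix.sub_apply, mul_sub]

/-- Scalars in the spin-blind factor: `(c • B) ⊗ Γ = c • (B ⊗ Γ)`. -/
theorem sliceKron_smul_left (c : ℂ) (B : Matrix (SliceColourVar Nf S) (SliceColourVar Nf S) ℂ)
    (Γ : Matrix (Fin 4) (Fin 4) ℂ) : sliceKron (c • B) Γ = c • sliceKron B Γ := by
  ext p q
  simp only [sliceKron, Matrix.of_apply, Matrix.smul_apply, smul_eq_mul, mul_assoc]

/-- Scalars in the spin factor: `B ⊗ (c • Γ) = c • (B ⊗ Γ)`. -/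
theorem sliceKron_smul_right (c : ℂ) (B : Matrix (SliceColourVar Nf S) (SliceColourVar Nf S) ℂ)
    (Γ : Matrix (Fin 4) (Fin 4) ℂ) : sliceKron B (c • Γ) = c • sliceKron B Γ := by
  ext p q
  simp only [sliceKron, Matrix.of_apply, Matrix.smul_apply, smul_eq_mul]
  ring

/-- Finite sums in the spin-blind factor: `(∑ᵢ Bᵢ) ⊗ Γ = ∑ᵢ (Bᵢ ⊗ Γ)`. -/
theorem sliceKron_sum_left {ι : Type*} (s : Finset ι)
    (B : ι → Matrix (SliceColourVar Nf S) (SliceColourVar Nf S) ℂ) (Γ : Matrix (Fin 4) (Fin 4) ℂ) :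
    sliceKron (∑ i ∈ s, B i) Γ = ∑ i ∈ s, sliceKron (B i) Γ := by
  ext p q
  simp only [sliceKron, Matrix.of_apply, Matrix.sum_apply, Finset.sum_mul]

/-- Finite sums in the spin factor: `B ⊗ (∑ᵢ Γᵢ) = ∑ᵢ (B ⊗ Γᵢ)`. -/
theorem sliceKron_sum_right {ι : Type*} (s : Finset ι)
    (B : Matrix (SliceColourVar Nf S) (SliceColourVar Nf S) ℂ) (Γ : ι → Matrix (Fin 4) (Fin 4) ℂ) :
    sliceKron B (∑ i ∈ s, Γ i) = ∑ i ∈ s, sliceKron B (Γ i) := by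
  ext p q
  simp only [sliceKron, Matrix.of_apply, Matrix.sum_apply, Finset.mul_sum]

/-- Conjugate transpose: `(B ⊗ Γ)ᴴ = Bᴴ ⊗ Γᴴ`. -/
theorem sliceKron_conjTranspose (B : Matrix (SliceColourVar Nf S) (SliceColourVar Nf S) ℂ)
    (Γ : Matrix (Fin 4) (Fin 4) ℂ) : (sliceKron B Γ)ᴴ = sliceKron Bᴴ Γᴴ := by
  ext p q
  simp only [sliceKron, Matrix.conjTranspose_apply, Matrix.of_apply, star_mul']

variable [NeZero S]

/-! ### `sliceKron` is a transported Kronecker product -/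

/-- `sliceKron B Γ` is Mathlib's Kronecker product `B ⊗ₖ Γ` transported along the reassociation
`(flavour × (site × colour)) × spin ≃ flavour × (site × (colour × spin))`,
`((f, x, a), α) ↦ (f, x, a, α)`. -/
theorem sliceKron_eq_reindex (B : Matrix (SliceColourVar Nf S) (SliceColourVar Nf S) ℂ)
    (Γ : Matrix (Fin 4) (Fin 4) ℂ) :
    sliceKron B Γ =
      Matrix.reindexAlgEquiv ℂ ℂ
        ((Equiv.prodAssoc (Fin Nf) (TorusSite 3 S × Fin 3) (Fin 4)).trans
          (Equiv.prodCongr (Equiv.refl (Fin Nf))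
            (Equiv.prodAssoc (TorusSite 3 S) (Fin 3) (Fin 4))))
        (B ⊗ₖ Γ) := by
  ext ⟨f, x, a, α⟩ ⟨g, y, b, β⟩
  rfl

/-- **Multiplicativity**: `(B₁ ⊗ Γ₁)(B₂ ⊗ Γ₂) = (B₁B₂) ⊗ (Γ₁Γ₂)`. -/
theorem sliceKron_mul (B₁ B₂ : Matrix (SliceColourVar Nf S) (SliceColourVar Nf S) ℂ)
    (Γ₁ Γ₂ : Matrix (Fin 4) (Fin 4) ℂ) :
    sliceKron B₁ Γ₁ * sliceKron B₂ Γ₂ = sliceKron (B₁ * B₂) (Γ₁ * Γ₂) := by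
  rw [sliceKron_eq_reindex, sliceKron_eq_reindex, sliceKron_eq_reindex, ← map_mul,
    ← Matrix.mul_kronecker_mul]

/-- `1 ⊗ 1 = 1`. -/
theorem sliceKron_one_one :
    sliceKron (1 : Matrix (SliceColourVar Nf S) (SliceColourVar Nf S) ℂ) 1 = 1 := by
  rw [sliceKron_eq_reindex, Matrix.one_kronecker_one, map_one]

/-- Mixed factors commute: `(B ⊗ 1)(1 ⊗ Γ) = B ⊗ Γ = (1 ⊗ Γ)(B ⊗ 1)`. -/
theorem sliceKron_one_comm (B : Matrix (SliceColourVar Nf S) (SliceColourVar Nf S) ℂ)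
    (Γ : Matrix (Fin 4) (Fin 4) ℂ) :
    sliceKron B 1 * sliceKron 1 Γ = sliceKron B Γ ∧ sliceKron 1 Γ * sliceKron B 1 = sliceKron B Γ := by
  rw [sliceKron_mul, sliceKron_mul, Matrix.mul_one, Matrix.one_mul, Matrix.mul_one, Matrix.one_mul]
  exact ⟨rfl, rfl⟩

/-- Determinant: `det (B ⊗ Γ) = (det B)⁴ · (det Γ) ^ #(flavour × site × colour)`. -/
theorem det_sliceKron (B : Matrix (SliceColourVar Nf S) (SliceColourVar Nf S) ℂ)
    (Γ : Matrix (Fin 4) (Fin 4) ℂ) :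
    (sliceKron B Γ).det = B.det ^ 4 * Γ.det ^ Fintype.card (SliceColourVar Nf S) := by
  rw [sliceKron_eq_reindex, Matrix.det_reindexAlgEquiv, Matrix.det_kronecker, Fintype.card_fin]

/-! ### The spin projections `P± = ½ (1 ± γ₄)` lifted to the slice quark modes
(the `4 × 4` identities `P⁺P⁻ = 0 = P⁻P⁺`, `P±P± = P±`, `P±ᴴ = P±` are the tree's
`timeProjPlus_mul_timeProjMinus` and the landed `TimeKernelPosDef.timeProjMinus_mul_timeProjPlus`,
`TimeKernelPosDef.timeProj{Plus,Minus}_mul_self`, `TimeKernelPosDef.timeProj{Plus,Minus}_isHermitian`) -/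

/-- `(1 ⊗ P⁺)(1 ⊗ P⁻) = 0` on the slice quark modes. -/
theorem sliceKron_timeProjPlus_mul_timeProjMinus :
    sliceKron (1 : Matrix (SliceColourVar Nf S) (SliceColourVar Nf S) ℂ) timeProjPlus *
        sliceKron 1 timeProjMinus = 0 := by
  rw [sliceKron_mul, Matrix.mul_one, timeProjPlus_mul_timeProjMinus, sliceKron_zero_right]

/-- `(1 ⊗ P⁻)(1 ⊗ P⁺) = 0` on the slice quark modes. -/
theorem sliceKron_timeProjMinus_mul_timeProjPlus :
    sliceKron (1 : Matrix (SliceColourVar Nf S) (SliceColourVar Nf S) ℂ) timeProjMinus *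
        sliceKron 1 timeProjPlus = 0 := by
  rw [sliceKron_mul, Matrix.mul_one, TimeKernelPosDef.timeProjMinus_mul_timeProjPlus,
    sliceKron_zero_right]

/-- `1 ⊗ P⁺` is idempotent on the slice quark modes. -/
theorem sliceKron_timeProjPlus_mul_self :
    sliceKron (1 : Matrix (SliceColourVar Nf S) (SliceColourVar Nf S) ℂ) timeProjPlus *
        sliceKron 1 timeProjPlus = sliceKron 1 timeProjPlus := by
  rw [sliceKron_mul, Matrix.mul_one, TimeKernelPosDef.timeProjPlus_mul_self]

/-- `1 ⊗ P⁻` is idempotent on the slice quark modes. -/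
theorem sliceKron_timeProjMinus_mul_self :
    sliceKron (1 : Matrix (SliceColourVar Nf S) (SliceColourVar Nf S) ℂ) timeProjMinus *
        sliceKron 1 timeProjMinus = sliceKron 1 timeProjMinus := by
  rw [sliceKron_mul, Matrix.mul_one, TimeKernelPosDef.timeProjMinus_mul_self]

/-- `1 ⊗ P⁺ + 1 ⊗ P⁻ = 1` on the slice quark modes. -/
theorem sliceKron_timeProjPlus_add_timeProjMinus :
    sliceKron (1 : Matrix (SliceColourVar Nf S) (SliceColourVar Nf S) ℂ) timeProjPlus +
        sliceKron 1 timeProjMinus = 1 := by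
  rw [← sliceKron_add_right, timeProjPlus_add_timeProjMinus, sliceKron_one_one]

/-! ### `N² = 0` and the unit `1 − N` -/

/-- A sandwich `Pm D Pp` with `Pp Pm = 0` squares to zero. -/
theorem sandwich_mul_self_eq_zero {n : Type*} [Fintype n] (Pm D Pp : Matrix n n ℂ)
    (h : Pp * Pm = 0) : Pm * D * Pp * (Pm * D * Pp) = 0 := by
  have e : Pm * D * Pp * (Pm * D * Pp) = Pm * D * (Pp * Pm) * D * Pp := by
    simp only [Matrix.mul_assoc]
  rw [e, h, Matrix.mul_zero, Matrix.zero_mul, Matrix.zero_mul]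

/-- In any ring, `N² = 0` makes `1 - N` a unit with two-sided inverse `1 + N`. -/
theorem one_sub_mul_one_add_of_mul_self {R : Type*} [Ring R] (N : R) (h : N * N = 0) :
    (1 - N) * (1 + N) = 1 ∧ (1 + N) * (1 - N) = 1 := by
  constructor
  · rw [mul_add, sub_mul, sub_mul, one_mul, one_mul, mul_one, h, sub_zero, sub_add_cancel]
  · rw [mul_sub, mul_one, add_mul, one_mul, h, add_zero, add_sub_cancel_right]

/-- **`N² = 0`** for the pair coupling `N = (1 ⊗ P⁻) D (1 ⊗ P⁺)` (`sliceNilp`): the inner factor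
`(1 ⊗ P⁺)(1 ⊗ P⁻) = 1 ⊗ (P⁺P⁻) = 0`. -/
theorem sliceNilp_mul_self (U : GaugeConfig 3 S (Matrix.specialUnitaryGroup (Fin 3) ℂ)) :
    sliceNilp (Nf := Nf) U * sliceNilp U = 0 :=
  sandwich_mul_self_eq_zero _ _ _ sliceKron_timeProjPlus_mul_timeProjMinus

/-- `N` is nilpotent. -/
theorem isNilpotent_sliceNilp (U : GaugeConfig 3 S (Matrix.specialUnitaryGroup (Fin 3) ℂ)) :
    IsNilpotent (sliceNilp (Nf := Nf) U) :=
  ⟨2, (pow_two _).trans (sliceNilp_mul_self U)⟩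

/-- `e^{-N} = 1 - N` has the explicit two-sided inverse `e^{N} = 1 + N`. -/
theorem one_sub_sliceNilp_mul_one_add (U : GaugeConfig 3 S (Matrix.specialUnitaryGroup (Fin 3) ℂ)) :
    (1 - sliceNilp (Nf := Nf) U) * (1 + sliceNilp U) = 1 ∧
      (1 + sliceNilp (Nf := Nf) U) * (1 - sliceNilp U) = 1 :=
  one_sub_mul_one_add_of_mul_self _ (sliceNilp_mul_self U)

/-- `1 - N` is a unit. -/
theorem isUnit_one_sub_sliceNilp (U : GaugeConfig 3 S (Matrix.specialUnitaryGroup (Fin 3) ℂ)) :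
    IsUnit (1 - sliceNilp (Nf := Nf) U) :=
  (isNilpotent_sliceNilp U).isUnit_one_sub

/-- `Nᴴ` also squares to zero, and `1 - Nᴴ` is a unit (the right-hand factor of `M_F(U)`). -/
theorem sliceNilp_conjTranspose_mul_self_and_isUnit
    (U : GaugeConfig 3 S (Matrix.specialUnitaryGroup (Fin 3) ℂ)) :
    (sliceNilp (Nf := Nf) U)ᴴ * (sliceNilp U)ᴴ = 0 ∧ IsUnit (1 - (sliceNilp (Nf := Nf) U)ᴴ) := by
  have h : (sliceNilp (Nf := Nf) U)ᴴ * (sliceNilp U)ᴴ = 0 := by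
    rw [← Matrix.conjTranspose_mul, sliceNilp_mul_self, Matrix.conjTranspose_zero]
  exact ⟨h, IsNilpotent.isUnit_one_sub ⟨2, (pow_two _).trans h⟩⟩

end SliceNilpotent

/-- **Stub `sliceNilp_mul_self_and_isUnit` of line `Sketch`.**  The pair coupling
`N = (1 ⊗ P⁻) D (1 ⊗ P⁺)` of the fermionic transfer matrix (Smit §6.5 (6.84), (6.91)) squares to
zero because `P⁺P⁻ = 0`, and consequently `1 − N = e^{−N}` is invertible (inverse `1 + N`). -/
theorem sliceNilp_mul_self_and_isUnit :
    ∀ (Nf S : ℕ) [NeZero S] (U : GaugeConfig 3 S (Matrix.specialUnitaryGroup (Fin 3) ℂ)),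
      sliceNilp (Nf := Nf) U * sliceNilp U = 0 ∧ IsUnit (1 - sliceNilp (Nf := Nf) U) :=
  fun _ _ _ U => ⟨SliceNilpotent.sliceNilp_mul_self U, SliceNilpotent.isUnit_one_sub_sliceNilp U⟩

end Summit.QuantumFields.QCD.Cruxes.StableActionBridge.Sketch

end
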